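import Summits.CriticalPhenomena.PercolationContinuityZ3.Theorems.Transplant.HalfSlabUniquenessArms
import HarnessLib

/-!
# Uniqueness in half-slabs, II: shadows on a general coordinate plane, the crossing, and the move of a link

builds on p205010 (kernel theorem, internal audit signed; external expert review pending) — NOT used in this file.
Lane `prim-bschramm`, seat `prim-bschramm-p2` (gen 22; class C1b, METHOD = input substitution; memo `HOME/bschramm/P2-LATTICES.md` §68);
helper file (`--supports stmt-CriticalPhenomena-4575 --as helper`) of the HALF-SLAB UNIQUENESS programme (see `HalfSlabUniquenessArms`).

* §1 shadows on the `(x_i, x_j)`-plane of `ℤ^d` for ANY two distinct coordinates (`HSU.exists_common_shadow_of_crossing` is the case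
  `j = 0`): `shadow₂_adj_or_eq`, `exists_shadow₂_walk`, **`exists_common_shadow₂_of_crossing`** — a walk crossing the shadow rectangle
  `[L, R] × [B, T]` from `{x_i = L}` to `{x_i = R}` and a walk crossing it from `{x_j = B}` to `{x_j = T}` have vertices with the same
  shadow (planar crossing lemma `exists_mem_support_of_crossing` applied to the shadow walks);
* §2 **`link_crossing`** (slab `S_k ⊂ ℤ³`, shadow plane `(x₂, x₁)`, fibre `x₀`): on the link event, if the port is not below the apex
  (`b₁ ≤ w₁`), the truncated steep region lies in the strip `{w₂ ≤ x₂ ≤ Z}` and the truncated shallow region lies below `{x₁ ≤ T}`, then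
  the steep arm (a bottom-to-top crossing of `[w₂, Z] × [b₁, T]`) and the shallow arm (a left-to-right crossing) pass through a common
  fibre `{(x₁, x₂) = const}`; **`link_move`**: for ANY step graph `K` containing the lattice steps inside the two regions and inside the
  fibre segment between such a pair, `≤ k` extra open edges (the fibre segment, inside the window `[-M, M]³`) join the apex to the port
  through open `K`-steps.
[cite: AizenmanChayesChayesFrohlichRusso1983, §4 Lemma 4.3 (overlapping paths), Lemma 4.2 (a)]
[cite: DuminilCopinSidoraviciusTassion2016, §2.2 (before Lemma 6: projections of paths intersect)] -/

noncomputable section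

namespace Summit.CriticalPhenomena.PercolationContinuityZ3.Theorems.Transplant

namespace HalfSlabUniq

open MeasureTheory Literature.Probability.Percolation Literature.Probability.LatticeModels SimpleGraph HSU OrthantUniq
open scoped Classical

/-! ## §1 Shadows on the coordinate plane `(x_i, x_j)` of `ℤ^d` -/

section Shadow

variable {d : ℕ} {i j : Fin d}

/-- A lattice step of `ℤ^d` either fixes the shadow `(x_i, x_j)` or moves it by a lattice step of `ℤ²` (`i ≠ j`). [folklore] -/
theorem shadow₂_adj_or_eq (hij : i ≠ j) {x y : Site d} (h : (zdGraph d).Adj x y) :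
    (zdGraph 2).Adj (![x i, x j] : Site 2) ![y i, y j] ∨ (![x i, x j] : Site 2) = ![y i, y j] := by
  wlog hxy : ∃ m, y = x + Pi.single m 1 generalizing x y
  · obtain ⟨m, hm | hm⟩ := (zdGraph_adj_iff x y).1 h
    · exact this h ⟨m, hm⟩
    · rcases this h.symm ⟨m, hm⟩ with h' | h'
      · exact Or.inl h'.symm
      · exact Or.inr h'.symm
  obtain ⟨m, rfl⟩ := hxy
  by_cases hmi : m = i
  · subst hmi
    left
    rw [zdGraph_adj_iff]
    refine ⟨0, Or.inl ?_⟩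
    ext l; fin_cases l <;> simp [Pi.single_eq_of_ne (Ne.symm hij)]
  · by_cases hmj : m = j
    · subst hmj
      left
      rw [zdGraph_adj_iff]
      refine ⟨1, Or.inl ?_⟩
      ext l; fin_cases l <;> simp [Pi.single_eq_of_ne hij]
    · right
      ext l; fin_cases l <;> simp [Ne.symm hmi, Ne.symm hmj]

/-- **Every walk of `ℤ^d` has a shadow walk in `ℤ²`** on the `(x_i, x_j)`-plane (`i ≠ j`; steps in the other coordinates deleted), all
of whose vertices are shadows of vertices of the walk. [folklore] -/
theorem exists_shadow₂_walk (hij : i ≠ j) {a b : Site d} (P : (zdGraph d).Walk a b) :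
    ∃ P' : (zdGraph 2).Walk (![a i, a j] : Site 2) ![b i, b j], ∀ w ∈ P'.support, ∃ z ∈ P.support, (![z i, z j] : Site 2) = w := by
  induction P with
  | nil =>
    refine ⟨Walk.nil, fun w hw => ?_⟩
    rw [Walk.support_nil, List.mem_singleton] at hw
    exact ⟨_, Walk.start_mem_support _, hw.symm⟩
  | @cons u v w h p ih =>
    obtain ⟨P', hP'⟩ := ih
    rcases shadow₂_adj_or_eq hij h with hadj | heq
    · refine ⟨Walk.cons hadj P', fun x hx => ?_⟩
      rw [Walk.support_cons, List.mem_cons] at hx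
      rcases hx with rfl | hx
      · exact ⟨u, Walk.start_mem_support _, rfl⟩
      · obtain ⟨z, hz, rfl⟩ := hP' x hx
        exact ⟨z, by rw [Walk.support_cons]; exact List.mem_cons_of_mem _ hz, rfl⟩
    · refine ⟨P'.copy heq.symm rfl, fun x hx => ?_⟩
      rw [Walk.support_copy] at hx
      obtain ⟨z, hz, rfl⟩ := hP' x hx
      exact ⟨z, by rw [Walk.support_cons]; exact List.mem_cons_of_mem _ hz, rfl⟩

/-- **Forced overlap on a general coordinate plane.** In `ℤ^d` (`i ≠ j`), let `P` be a walk from `{x_i = L}` to `{x_i = R}` and `Q` a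
walk from `{x_j = B}` to `{x_j = T}`, both with shadows inside the rectangle `[L, R] × [B, T]`.  Then some vertex of `P` and some vertex
of `Q` have the same shadow: `z_i = z'_i` and `z_j = z'_j` (ACCFR: the two paths "overlap").
[cite: AizenmanChayesChayesFrohlichRusso1983, §4 Lemma 4.3 (overlapping paths)] -/
theorem exists_common_shadow₂_of_crossing (hij : i ≠ j) {L R B T : ℤ} {a b c e : Site d}
    (P : (zdGraph d).Walk a b) (Q : (zdGraph d).Walk c e)
    (hP : ∀ z ∈ P.support, L ≤ z i ∧ z i ≤ R ∧ B ≤ z j ∧ z j ≤ T)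
    (hQ : ∀ z ∈ Q.support, L ≤ z i ∧ z i ≤ R ∧ B ≤ z j ∧ z j ≤ T)
    (ha : a i = L) (hb : b i = R) (hc : c j = B) (he : e j = T) :
    ∃ z ∈ P.support, ∃ z' ∈ Q.support, z i = z' i ∧ z j = z' j := by
  obtain ⟨P', hP'⟩ := exists_shadow₂_walk hij P
  obtain ⟨Q', hQ'⟩ := exists_shadow₂_walk hij Q
  have hP'in : ∀ w ∈ P'.support, L ≤ w 0 ∧ w 0 ≤ R ∧ B ≤ w 1 ∧ w 1 ≤ T := by
    intro w hw
    obtain ⟨z, hz, rfl⟩ := hP' w hw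
    simpa using hP z hz
  have hQ'in : ∀ w ∈ Q'.support, L ≤ w 0 ∧ w 0 ≤ R ∧ B ≤ w 1 ∧ w 1 ≤ T := by
    intro w hw
    obtain ⟨z, hz, rfl⟩ := hQ' w hw
    simpa using hQ z hz
  obtain ⟨w, hwP, hwQ⟩ := exists_mem_support_of_crossing P' Q' hP'in hQ'in (by simpa using ha) (by simpa using hb)
    (by simpa using hc) (by simpa using he)
  obtain ⟨z, hz, rfl⟩ := hP' w hwP
  obtain ⟨z', hz', hzz'⟩ := hQ' _ hwQ
  exact ⟨z, hz, z', hz', by simpa using (congrFun hzz' 0).symm, by simpa using (congrFun hzz' 1).symm⟩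

end Shadow

/-! ## §2 The crossing and the move of a link in the slab -/

section Link

variable {k : ℕ} {σ : ℤ} {b w : Site 3} {T Z : ℤ}

/-- **The crossing.** On the link event — with the port not below the apex (`b₁ ≤ w₁`), the truncated steep region inside the strip
`{w₂ ≤ x₂ ≤ Z}` and the truncated shallow region below `{x₁ ≤ T}` — some vertex `s` of the steep arm (reached from the apex inside the
steep region) and some vertex `t` of the shallow arm (reached from the port inside the shallow region) lie in a common fibre:
`(s₁, s₂) = (t₁, t₂)`.  The steep arm crosses the shadow rectangle `[w₂, Z] × [b₁, T]` from bottom to top, the shallow arm from left to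
right. [cite: AizenmanChayesChayesFrohlichRusso1983, §4 Lemma 4.3 (overlapping paths)] [cite: DuminilCopinSidoraviciusTassion2016, §2.2 (before Lemma 6)] -/
theorem link_crossing (hσ : σ = 1 ∨ σ = -1) (hb : b ∈ slab 3 k) (hw : w ∈ slab 3 k) (hbT : b 1 ≤ T) (hwZ : w 2 ≤ Z)
    (hbw : b 1 ≤ w 1) (hPz : ∀ x ∈ steepReg k σ b T, w 2 ≤ x 2 ∧ x 2 ≤ Z) (hQy : ∀ x ∈ shallowReg k w Z, x 1 ≤ T)
    {ω : BondConfig (Site 3)} (hω : ω ∈ linkEvent k σ b w T Z) :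
    ∃ s t : Site 3, s ∈ steepReg k σ b T ∧ t ∈ shallowReg k w Z ∧ s 1 = t 1 ∧ s 2 = t 2 ∧
      (openGraph ω ⊓ withinGraph (zdGraph 3) (steepReg k σ b T)).Reachable b s ∧
      (openGraph ω ⊓ withinGraph (zdGraph 3) (shallowReg k w Z)).Reachable w t := by
  obtain ⟨⟨e, he, hS⟩, ⟨f, hf, hH⟩⟩ := hω
  simp only [Set.mem_setOf_eq] at he hf
  obtain ⟨P₀⟩ := mem_openConnVia_iff.1 hS
  obtain ⟨Q₀⟩ := mem_openConnVia_iff.1 hH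
  have hb_mem : b ∈ steepReg k σ b T := apex_mem_steepReg hb hbT
  have hw_mem : w ∈ shallowReg k w Z := port_mem_shallowReg hw hwZ
  have hPsupp : ∀ z ∈ P₀.support, z ∈ steepReg k σ b T := support_subset_of_walk_within P₀ hb_mem
  have hQsupp : ∀ z ∈ Q₀.support, z ∈ shallowReg k w Z := support_subset_of_walk_within Q₀ hw_mem
  let P := P₀.mapLe (openGraph_inf_withinGraph_le ω _)
  let Q := Q₀.mapLe (openGraph_inf_withinGraph_le ω _)
  -- the shallow arm crosses `[w₂, Z] × [b₁, T]` horizontally, the steep arm vertically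
  have hQbd : ∀ z ∈ Q.support, w 2 ≤ z 2 ∧ z 2 ≤ Z ∧ b 1 ≤ z 1 ∧ z 1 ≤ T := by
    intro z hz
    rw [Walk.support_mapLe_eq_support] at hz
    obtain ⟨-, h1, -, h3, h4⟩ := shallowReg_props (hQsupp z hz)
    exact ⟨h3, h4, hbw.trans h1, hQy z (hQsupp z hz)⟩
  have hPbd : ∀ z ∈ P.support, w 2 ≤ z 2 ∧ z 2 ≤ Z ∧ b 1 ≤ z 1 ∧ z 1 ≤ T := by
    intro z hz
    rw [Walk.support_mapLe_eq_support] at hz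
    obtain ⟨-, h1, h2, -⟩ := steepReg_props hσ (hPsupp z hz)
    exact ⟨(hPz z (hPsupp z hz)).1, (hPz z (hPsupp z hz)).2, h1, h2⟩
  obtain ⟨t, ht, s, hs, h2, h1⟩ := exists_common_shadow₂_of_crossing (i := (2 : Fin 3)) (j := 1) (by decide) Q P hQbd hPbd
    rfl hf rfl he
  rw [Walk.support_mapLe_eq_support] at ht hs
  exact ⟨s, t, hPsupp s hs, hQsupp t ht, h1.symm, h2.symm, reachable_of_mem_support' P₀ s hs, reachable_of_mem_support' Q₀ t ht⟩

/-- Two slab sites in a common fibre are at `ℓ¹`-distance `≤ k`. [folklore] -/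
theorem l1dist_le_of_fibre {s t : Site 3} (hs : s ∈ slab 3 k) (ht : t ∈ slab 3 k) (h1 : s 1 = t 1) (h2 : s 2 = t 2) :
    l1dist s t ≤ k := by
  rw [l1dist_of_eq_off 0 fun j hj => by fin_cases j <;> simp_all]
  have := hs.1; have := hs.2; have := ht.1; have := ht.2
  omega

/-- **The move on the link event**: under the hypotheses of `link_crossing`, for ANY step graph `K` containing the lattice steps inside
the two regions and inside the fibre segment (bounding box) of every steep/shallow pair of vertices in a common fibre, at most `k` extra
open edges inside the window `[-M, M]³` of the regions join the apex to the port through open `K`-steps.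
[cite: AizenmanChayesChayesFrohlichRusso1983, §4 Lemma 4.3 (overlap ⇒ connection after opening N sites) and Lemma 4.2 (a)] -/
theorem link_move (hσ : σ = 1 ∨ σ = -1) (hb : b ∈ slab 3 k) (hw : w ∈ slab 3 k) (hbT : b 1 ≤ T) (hwZ : w 2 ≤ Z)
    (hbw : b 1 ≤ w 1) (hPz : ∀ x ∈ steepReg k σ b T, w 2 ≤ x 2 ∧ x 2 ≤ Z) (hQy : ∀ x ∈ shallowReg k w Z, x 1 ≤ T)
    {K : SimpleGraph (Site 3)} (hKS : withinGraph (zdGraph 3) (steepReg k σ b T) ≤ K)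
    (hKH : withinGraph (zdGraph 3) (shallowReg k w Z) ≤ K)
    (hKJ : ∀ s ∈ steepReg k σ b T, ∀ t ∈ shallowReg k w Z, s 1 = t 1 → s 2 = t 2 →
      withinGraph (zdGraph 3) {z | ∀ j, min (s j) (t j) ≤ z j ∧ z j ≤ max (s j) (t j)} ≤ K)
    {M : ℕ} (hM : ∀ x ∈ steepReg k σ b T ∪ shallowReg k w Z, ∀ j, |x j| ≤ M)
    {ω : BondConfig (Site 3)} (hω : ω ∈ linkEvent k σ b w T Z) :
    ∃ F : Finset (Sym2 (Site 3)), F ⊆ edgesIn (zdGraph 3) (box 3 M) ∧ F.card ≤ k ∧ ω ∪ ↑F ∈ openConnVia K b w := by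
  obtain ⟨s, t, hs, ht, h1, h2, hPr, hQr⟩ := link_crossing hσ hb hw hbT hwZ hbw hPz hQy hω
  obtain ⟨F, hFc, hFs, hFr⟩ := exists_junction s t
  have hdist : l1dist s t ≤ k := l1dist_le_of_fibre (steepReg_props hσ hs).1 (shallowReg_props ht).1 h1 h2
  refine ⟨F, ?_, hFc.trans hdist, ?_⟩
  · intro e he
    exact edgeSet_withinGraph_subset_edgesIn (bbox_subset_boxSet (hM s (Or.inl hs)) (hM t (Or.inr ht))) (hFs (Finset.mem_coe.2 he))
  · refine mem_openConnVia_iff.2 ?_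
    have r1 : (openGraph (ω ∪ ↑F) ⊓ K).Reachable b s := reachable_of_arm hPr hKS
    have r2 : (openGraph (ω ∪ ↑F) ⊓ K).Reachable s t := reachable_of_junction hFr (subset_refl F) (hKJ s hs t ht h1 h2)
    have r3 : (openGraph (ω ∪ ↑F) ⊓ K).Reachable t w := (reachable_of_arm hQr hKH).symm
    exact r1.trans (r2.trans r3)

end Link

end HalfSlabUniq

end Summit.CriticalPhenomena.PercolationContinuityZ3.Theorems.Transplant

end
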